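import Summits.QuantumFields.YangMills.Theorems.BalabanUVNodesN19SourceSplit

/-!
# YM-DAG node N19 (= NE7 proper) — GUARDS OF THE SOURCE SPLIT: what ZERO SOURCE alone gives (ℓ¹-close class weights, first-moment matching —
# located remark), and the kernel guard that the VACUUM HALF is load-bearing on the `Core` road and invisible at the Z-level

Cell `pub-ymgap`, HUMAN RULING D-0062 (Track A), R141 (C) wider-strategy seat `pub-ymgap-dag-n19-e` (strategy s3 = ALTERNATIVE CURRENCY); SIBLING LEAF of
`…Theorems.BalabanUVNodesN19SourceSplit` (module 3 of the seat: `Spine.NE7.Core` ⟺ (V) class-uniform VACUUM matching at zero source ∧ (I) per-class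
SOURCE-RESPONSE matching), split off under the 400-line rule.  Route `Summits/QuantumFields/YangMills/Theses/BalabanUVNodes.lean` rev 15, cluster item K3′
«SpineGivenEndpointR12» (stmt-QuantumFields-19908; lineage K3 stmt-QuantumFields-19676); filed `--supports` that item `--as helper`.  COUNT-NEUTRAL: elementary
real analysis over abstract finite data; NOT a discharge claim; no route is opened or re-pointed.

WHAT IS KERNEL-CHECKED ([folklore]; 0 `def`, 0 `sorry`).
* §1 WHAT ZERO SOURCE ALONE GIVES — LOCATED REMARK (an abstract finite level, all classes good, positive class weights `a_τ` (run A), `b_τ` (run B)).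
  `one_sub_exp_neg_le_exp_sub_one` (`1 − e^{−x} ≤ e^{x} − 1`) · `sum_abs_classWeight_sub_le` (a vacuum sandwich `|log b_τ − log a_τ − c| ≤ η` for every
  class ⇒ the two runs' NORMALISED CLASS WEIGHTS are `ℓ¹`-close: `Σ_τ |b_τ∕Σb − a_τ∕Σa| ≤ e^{2η} − 1` — the totals inherit the sandwich
  (`NE7.sandwich_of_abs_log_sub_le`, `N19CoreMetric.abs_log_sub_log_sub_le_of_sandwich` BY NAME), so the normalised weights are sandwiched with `e^{∓2η}` and
  NO constant) · `abs_mixtureMean_sub_mixtureMean_le` ((V) + per-class insertion means `m^A`, `m^B` with `|m^A| ≤ M` agreeing within `λ` AT ZERO SOURCE ONLY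
  ⇒ FIRST-MOMENT matching `|Σ_τ b_τ m^B_τ∕Σb − Σ_τ a_τ m^A_τ∕Σa| ≤ λ + M·(e^{2η} − 1)`; `d∕dt log Σ_τ A_τ(t)` at `t = 0` is such a mixture of the
  per-class tilted insertion means).  That is the per-string shape the apex's `T4VarianceMatching.ExpectCauchyRate` socket consumes
  (`hasContinuumLimit_of_expectCauchyRate`), NOT K3′'s `S_N19`: what the source ball `|t| ≤ l₀` buys on THIS route is the whole generating function of one
  string (at the apex the two are interchangeable, `T4GenFunConverse.hasContinuumLimit_iff_genFunCauchy`).  Located for the planner — a producer that controls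
  the observable insertion only to first order at zero source feeds the apex through that socket, not through `S_N19`; bad classes would enter through N20's
  weights exactly as on the source-ball road (not typed here).
* §2 KERNEL GUARD: THE VACUUM HALF IS LOAD-BEARING ON THE `Core` ROAD AND INVISIBLE AT THE Z-LEVEL.  Two classes `τ ∈ {0, 1}` (`Fin 2`), no bad class,
  source-free cores `P ≡ (1 + e)∕2`, `Q(τ) = e^{τ}`: the insertion half (I) holds with ZERO remainder (`insertion_twoClassToy`, module 3's hypothesis shape
  verbatim); the summed partition functions `Σ_τ P = Σ_τ Q = 1 + e` satisfy E1∕E2 and N19's DECL target `Spine.NE7.Target vol l₀ 0 Z` with ZERO remainder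
  (`target_twoClassToy`); yet `Core` FAILS at every level with `vol·δ_K < 1∕2` (`not_core_twoClassToy`: the two classes' vacuum log-ratios differ by `1`),
  so NO summable `Core` family exists (`not_coreEdge_twoClassToy`, `0 < vol`) and — by module 3's `core_of_vacuum_of_insertion` BY NAME — NO summable
  vacuum half (`not_vacuumEdge_twoClassToy`).  Class-uniformity of the vacuum constants is content of NE7 proper (hence of K3′'s `S_N19`) that the DECL
  target at the partition functions does not see.  A located remark, NOT a defect: the term-wise road is SUFFICIENT by design (`NE7.target_of_hybridNE7`),
  and on Bałaban's classes a class-dependent vacuum discrepancy is what the bad classes and N20's relative weights are for.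

HONEST FRAMING.  NE7 ∕ NE7b ∕ NE7c are NOT PRINTED ([Balaban1987RG1]–[Balaban1989LargeFieldII] bound ONE run uniformly in `ε`; printed template [King1986]
(3.10)–(3.13) pp. 656–657, context only) and NOT PROVED; §1's weights ∕ means and §2's toy are abstract reals over finite index sets ∕ `Fin 2` (no Bałaban
object); nothing of Bałaban's is asserted or instantiated; N19 is NOT discharged; Track A count unmoved (A 5∕28).  One finite four-torus at fixed ε, rung
(B)+1 — NOT infinite volume, NOT OS on ℝ⁴, NOT a mass gap, NOT Clay.  THEOREMS ONLY; 0 sorry; standard axioms.  No decl below carries a cite tag.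
-/

set_option autoImplicit false

noncomputable section

open Finset Filter Topology
open scoped BigOperators

namespace Summit.QuantumFields.YangMills.BalabanUVNodes.N19SourceSplitGuards

open Literature.MathematicalPhysics.QuantumFieldTheory.Balaban1983to89
open T4CauchySum (MatchingModConstants genFun)
open Summit.QuantumFields.BalabanUV.T4Continuum.Spine
open Summit.QuantumFields.YangMills.BalabanUVNodes.N19CoreMetric (abs_log_sub_log_sub_le_of_sandwich)
open Summit.QuantumFields.YangMills.BalabanUVNodes.N19SourceSplit (core_of_vacuum_of_insertion)

/-! ## §1 What zero source alone gives: ℓ¹-close class weights and first-moment matching — located remark [folklore] -/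

section ZeroSource

variable {ι : Type*} {T : Finset ι} {a b mA mB : ι → ℝ} {c η lam M : ℝ}

/-- `1 − e^{−x} ≤ e^{x} − 1` (i.e. `2 ≤ e^{x} + e^{−x}`, from `1 + y ≤ e^{y}` at `y = ±x`). [folklore] -/
theorem one_sub_exp_neg_le_exp_sub_one (x : ℝ) : 1 - Real.exp (-x) ≤ Real.exp x - 1 := by
  have h1 := Real.add_one_le_exp x
  have h2 := Real.add_one_le_exp (-x)
  linarith

/-- **A VACUUM SANDWICH MAKES THE TWO RUNS' CLASS WEIGHTS `ℓ¹`-CLOSE.**  On a finite all-good level with positive weights, `|log b_τ − log a_τ − c| ≤ η`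
for every class gives `Σ_τ |b_τ∕Σb − a_τ∕Σa| ≤ e^{2η} − 1`: the totals inherit the sandwich, so the normalised weights are sandwiched with
`e^{∓2η}` and no constant. [folklore] -/
theorem sum_abs_classWeight_sub_le (hT : T.Nonempty) (ha : ∀ τ ∈ T, 0 < a τ) (hb : ∀ τ ∈ T, 0 < b τ)
    (hV : ∀ τ ∈ T, |Real.log (b τ) - Real.log (a τ) - c| ≤ η) :
    ∑ τ ∈ T, |b τ / ∑ σ ∈ T, b σ - a τ / ∑ σ ∈ T, a σ| ≤ Real.exp (2 * η) - 1 := by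
  set ZA := ∑ σ ∈ T, a σ with hZA_def
  set ZB := ∑ σ ∈ T, b σ with hZB_def
  have hZA : 0 < ZA := Finset.sum_pos ha hT
  have hZB : 0 < ZB := Finset.sum_pos hb hT
  have hsand : ∀ τ ∈ T, Real.exp (c - η) * a τ ≤ b τ ∧ b τ ≤ Real.exp (c + η) * a τ := fun τ hτ =>
    NE7.sandwich_of_abs_log_sub_le (ha τ hτ) (hb τ hτ) (hV τ hτ)
  have hZlo : Real.exp (c - η) * ZA ≤ ZB := by
    rw [hZA_def, Finset.mul_sum]
    exact Finset.sum_le_sum fun τ hτ => (hsand τ hτ).1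
  have hZhi : ZB ≤ Real.exp (c + η) * ZA := by
    rw [hZA_def, Finset.mul_sum]
    exact Finset.sum_le_sum fun τ hτ => (hsand τ hτ).2
  have hZlog := abs_le.mp (abs_log_sub_log_sub_le_of_sandwich hZA hZlo hZhi)
  have key : ∀ τ ∈ T, |b τ / ZB - a τ / ZA| ≤ (Real.exp (2 * η) - 1) * (a τ / ZA) := by
    intro τ hτ
    have hμA : 0 < a τ / ZA := div_pos (ha τ hτ) hZA
    have hμB : 0 < b τ / ZB := div_pos (hb τ hτ) hZB
    have hτlog := abs_le.mp (hV τ hτ)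
    have hlog : |Real.log (b τ / ZB) - Real.log (a τ / ZA) - 0| ≤ 2 * η := by
      rw [Real.log_div (hb τ hτ).ne' hZB.ne', Real.log_div (ha τ hτ).ne' hZA.ne', sub_zero, abs_le]
      constructor <;> linarith [hτlog.1, hτlog.2, hZlog.1, hZlog.2]
    obtain ⟨hlo, hhi⟩ := NE7.sandwich_of_abs_log_sub_le hμA hμB hlog
    rw [zero_sub] at hlo
    rw [zero_add] at hhi
    have hneg := one_sub_exp_neg_le_exp_sub_one (2 * η)
    rw [abs_le]
    constructor <;> nlinarith [hμA.le]
  calc ∑ τ ∈ T, |b τ / ZB - a τ / ZA| ≤ ∑ τ ∈ T, (Real.exp (2 * η) - 1) * (a τ / ZA) := Finset.sum_le_sum key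
    _ = (Real.exp (2 * η) - 1) * ((∑ τ ∈ T, a τ) / ZA) := by rw [← Finset.mul_sum, Finset.sum_div]
    _ = Real.exp (2 * η) - 1 := by rw [← hZA_def, div_self hZA.ne', mul_one]

/-- **FIRST-MOMENT MATCHING AT ZERO SOURCE.**  On a finite all-good level: positive class weights `a`, `b` with the vacuum sandwich
`|log b_τ − log a_τ − c| ≤ η`, and per-class insertion means `m^A`, `m^B` with `|m^A_τ| ≤ M` and `|m^B_τ − m^A_τ| ≤ λ` (agreement AT ZERO SOURCE ONLY)
give `|Σ_τ b_τ m^B_τ ∕ Σb − Σ_τ a_τ m^A_τ ∕ Σa| ≤ λ + M·(e^{2η} − 1)` — the two runs' expectations of the observable (`d∕dt log Z` at `t = 0` is such a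
mixture) agree.  This is the per-string shape of the apex's `T4VarianceMatching.ExpectCauchyRate` socket, NOT of K3's `S_N19`; located remark only.
[folklore] -/
theorem abs_mixtureMean_sub_mixtureMean_le (hT : T.Nonempty) (ha : ∀ τ ∈ T, 0 < a τ) (hb : ∀ τ ∈ T, 0 < b τ)
    (hV : ∀ τ ∈ T, |Real.log (b τ) - Real.log (a τ) - c| ≤ η) (hM : ∀ τ ∈ T, |mA τ| ≤ M)
    (hm : ∀ τ ∈ T, |mB τ - mA τ| ≤ lam) :
    |(∑ τ ∈ T, b τ * mB τ) / (∑ σ ∈ T, b σ) - (∑ τ ∈ T, a τ * mA τ) / (∑ σ ∈ T, a σ)| ≤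
      lam + M * (Real.exp (2 * η) - 1) := by
  set ZA := ∑ σ ∈ T, a σ with hZA_def
  set ZB := ∑ σ ∈ T, b σ with hZB_def
  have hZA : 0 < ZA := Finset.sum_pos ha hT
  have hZB : 0 < ZB := Finset.sum_pos hb hT
  obtain ⟨τ₀, hτ₀⟩ := hT
  have hM0 : 0 ≤ M := (abs_nonneg _).trans (hM τ₀ hτ₀)
  have hw := sum_abs_classWeight_sub_le ⟨τ₀, hτ₀⟩ ha hb hV
  rw [← hZA_def, ← hZB_def] at hw
  have e : (∑ τ ∈ T, b τ * mB τ) / ZB - (∑ τ ∈ T, a τ * mA τ) / ZA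
      = ∑ τ ∈ T, (b τ / ZB * (mB τ - mA τ) + (b τ / ZB - a τ / ZA) * mA τ) := by
    rw [Finset.sum_div, Finset.sum_div, ← Finset.sum_sub_distrib]
    exact Finset.sum_congr rfl fun τ _ => by ring
  rw [e]
  have hμBsum : ∑ τ ∈ T, b τ / ZB = 1 := by rw [← Finset.sum_div, ← hZB_def, div_self hZB.ne']
  calc |∑ τ ∈ T, (b τ / ZB * (mB τ - mA τ) + (b τ / ZB - a τ / ZA) * mA τ)|
      ≤ ∑ τ ∈ T, |b τ / ZB * (mB τ - mA τ) + (b τ / ZB - a τ / ZA) * mA τ| := Finset.abs_sum_le_sum_abs _ _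
    _ ≤ ∑ τ ∈ T, (b τ / ZB * lam + |b τ / ZB - a τ / ZA| * M) := by
        refine Finset.sum_le_sum fun τ hτ => (abs_add_le _ _).trans (add_le_add ?_ ?_)
        · rw [abs_mul, abs_of_pos (div_pos (hb τ hτ) hZB)]
          exact mul_le_mul_of_nonneg_left (hm τ hτ) (div_pos (hb τ hτ) hZB).le
        · rw [abs_mul]
          exact mul_le_mul_of_nonneg_left (hM τ hτ) (abs_nonneg _)
    _ = lam * ∑ τ ∈ T, b τ / ZB + M * ∑ τ ∈ T, |b τ / ZB - a τ / ZA| := by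
        rw [Finset.sum_add_distrib, Finset.mul_sum, Finset.mul_sum]
        congr 1 <;> exact Finset.sum_congr rfl fun τ _ => by ring
    _ ≤ lam + M * (Real.exp (2 * η) - 1) := by
        rw [hμBsum, mul_one]
        exact add_le_add le_rfl (mul_le_mul_of_nonneg_left hw hM0)

end ZeroSource

/-! ## §2 Kernel guard: the vacuum half is load-bearing on the `Core` road and invisible at the Z-level [folklore] -/

section Toy

/-- THE TWO-CLASS TOY satisfies the insertion half with ZERO remainder (its cores `P ≡ (1+e)∕2`, `Q(τ) = e^{τ}` are source-free). [folklore] -/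
theorem insertion_twoClassToy (l₀ vol : ℝ) :
    ∀ K (t : ℝ), |t| ≤ l₀ → ∀ τ ∈ (fun _ : ℕ => (Finset.univ : Finset (Fin 2))) K \ (fun (_ : ℕ) (_ : ℝ) => (∅ : Finset (Fin 2))) K t,
      |(Real.log ((fun (_ : ℕ) (_ : ℝ) (τ : Fin 2) => Real.exp ((τ : ℕ) : ℝ)) K t τ) -
          Real.log ((fun (_ : ℕ) (_ : ℝ) (_ : Fin 2) => (1 + Real.exp 1) / 2) K t τ)) -
        (Real.log ((fun (_ : ℕ) (_ : ℝ) (τ : Fin 2) => Real.exp ((τ : ℕ) : ℝ)) K 0 τ) -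
          Real.log ((fun (_ : ℕ) (_ : ℝ) (_ : Fin 2) => (1 + Real.exp 1) / 2) K 0 τ))| ≤ vol * (fun _ : ℕ => (0 : ℝ)) K := by
  intro K t _ τ _
  simp

/-- … its summed partition functions `Z_K(t) = 1 + e` satisfy E1∕E2 (`Σ_τ P = Σ_τ Q = 1 + e`) and N19's DECL target `Spine.NE7.Target vol l₀ 0 Z`
(matching with ZERO remainder: everything is source-free). [folklore] -/
theorem target_twoClassToy (vol l₀ : ℝ) :
    NE7.Target vol l₀ (fun _ => 0) (fun _ _ => 1 + Real.exp 1) ∧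
    (∀ (K : ℕ) (t : ℝ), (1 + Real.exp 1) = ∑ τ : Fin 2, (fun (_ : ℕ) (_ : ℝ) (_ : Fin 2) => (1 + Real.exp 1) / 2) K t τ) ∧
    (∀ (K : ℕ) (t : ℝ), (1 + Real.exp 1) = ∑ τ : Fin 2, (fun (_ : ℕ) (_ : ℝ) (τ : Fin 2) => Real.exp ((τ : ℕ) : ℝ)) K t τ) := by
  refine ⟨⟨fun K => ⟨0, fun t _ => by simp⟩, summable_zero⟩, fun K t => ?_, fun K t => ?_⟩
  · simp [Finset.sum_const]
    ring
  · simp [Fin.sum_univ_two]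

/-- … yet `Core` FAILS at every level with `vol·δ_K < 1∕2`: the two classes' vacuum log-ratios differ by `1`, so no single constant serves both. [folklore] -/
theorem not_core_twoClassToy {l₀ vol : ℝ} {δ : ℕ → ℝ} (hl₀ : 0 ≤ l₀) {K : ℕ} (hK : vol * δ K < 1 / 2) :
    ¬ NE7.Core l₀ vol (fun _ : ℕ => (Finset.univ : Finset (Fin 2))) (fun (_ : ℕ) (_ : ℝ) => (∅ : Finset (Fin 2)))
        (fun (_ : ℕ) (_ : ℝ) (_ : Fin 2) => (1 + Real.exp 1) / 2) (fun (_ : ℕ) (_ : ℝ) (τ : Fin 2) => Real.exp ((τ : ℕ) : ℝ)) δ := by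
  intro h
  obtain ⟨c, hc⟩ := h K
  have h0 : |(0 : ℝ)| ≤ l₀ := by simpa using hl₀
  have hPpos : (0 : ℝ) < (1 + Real.exp 1) / 2 := by positivity
  have g0 := hc 0 h0 0 (by simp)
  have g1 := hc 0 h0 1 (by simp)
  have a0 := abs_le.mp (abs_log_sub_log_sub_le_of_sandwich hPpos g0.1 g0.2)
  have a1 := abs_le.mp (abs_log_sub_log_sub_le_of_sandwich hPpos g1.1 g1.2)
  simp only [Fin.val_zero, Nat.cast_zero, Fin.val_one, Nat.cast_one, Real.log_exp] at a0 a1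
  linarith [a0.1, a0.2, a1.1, a1.2]

/-- **THE GUARD**: hence the toy has NO summable `Core` family (`0 < vol`) — while (I) holds with zero remainder and the partition functions meet
N19's DECL target with zero remainder.  Class-uniformity of the vacuum constants is content of the `Core` road that the Z-level does not see. [folklore] -/
theorem not_coreEdge_twoClassToy {l₀ vol : ℝ} (hl₀ : 0 ≤ l₀) (hvol : 0 < vol) :
    ¬ ∃ δ : ℕ → ℝ, NE7.Core l₀ vol (fun _ : ℕ => (Finset.univ : Finset (Fin 2))) (fun (_ : ℕ) (_ : ℝ) => (∅ : Finset (Fin 2)))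
        (fun (_ : ℕ) (_ : ℝ) (_ : Fin 2) => (1 + Real.exp 1) / 2) (fun (_ : ℕ) (_ : ℝ) (τ : Fin 2) => Real.exp ((τ : ℕ) : ℝ)) δ ∧
      Summable δ := by
  rintro ⟨δ, hcore, hδ⟩
  have hpos : (0 : ℝ) < 1 / (2 * vol) := by positivity
  obtain ⟨K, hK⟩ := (hδ.tendsto_atTop_zero.eventually (gt_mem_nhds hpos)).exists
  refine not_core_twoClassToy hl₀ (K := K) ?_ hcore
  calc vol * δ K < vol * (1 / (2 * vol)) := mul_lt_mul_of_pos_left hK hvol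
    _ = 1 / 2 := by field_simp

/-- **… SO NO SUMMABLE VACUUM HALF EXISTS FOR THE TOY** — by module 3's `core_of_vacuum_of_insertion` BY NAME (with `insertion_twoClassToy` as the
insertion half): the failure of the ∃δ-edge is carried ENTIRELY by the vacuum half (V); the DECL target at the partition functions does not see it
(`target_twoClassToy`). [folklore] -/
theorem not_vacuumEdge_twoClassToy {l₀ vol : ℝ} (hl₀ : 0 ≤ l₀) (hvol : 0 < vol) :
    ¬ ∃ δ₀ : ℕ → ℝ,
      (∀ K, ∃ c : ℝ, ∀ t : ℝ, |t| ≤ l₀ →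
        ∀ τ ∈ (fun _ : ℕ => (Finset.univ : Finset (Fin 2))) K \ (fun (_ : ℕ) (_ : ℝ) => (∅ : Finset (Fin 2))) K t,
          |Real.log ((fun (_ : ℕ) (_ : ℝ) (τ : Fin 2) => Real.exp ((τ : ℕ) : ℝ)) K 0 τ) -
              Real.log ((fun (_ : ℕ) (_ : ℝ) (_ : Fin 2) => (1 + Real.exp 1) / 2) K 0 τ) - c| ≤ vol * δ₀ K) ∧
      Summable δ₀ := by
  rintro ⟨δ₀, hV, hδ₀⟩
  refine not_coreEdge_twoClassToy hl₀ hvol ⟨fun K => δ₀ K + (fun _ : ℕ => (0 : ℝ)) K, ?_, hδ₀.add summable_zero⟩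
  exact core_of_vacuum_of_insertion (fun _ _ _ _ _ => by positivity) (fun _ _ _ τ _ => Real.exp_pos _) hV
    (insertion_twoClassToy l₀ vol)

end Toy

end Summit.QuantumFields.YangMills.BalabanUVNodes.N19SourceSplitGuards

end
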